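import Summits.QuantumFields.BalabanUV.Beta.FP.PeriodisedLamGaugeLeg
import Summits.QuantumFields.BalabanUV.Beta.SymAveragingWardRootedStencils
import Summits.QuantumFields.BalabanUV.Beta.SymShiftedSpread

/-!
# `BalabanUV.Beta.FP.PeriodisedLamGaugeLegDoor` — road «FP» (binder row D1), ROUTE T, the (J-a) dictionary's row `a1` at level 0, Λ SECTOR AT THE DOOR:
# **THE Λ HALF OF U21's WARD ROW `a1` IN CLOSED FORM, IN U21's OWN AVERAGING ROW `Q₁₀`** (sequel of `PeriodisedLamGaugeLeg`; companion of `PeriodisedFormGaugeLeg.torus_a1_wilson`)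

HONEST DEPENDENCY (page 1, mandatory): continuum YM on T⁴ ⇐ BetaPertH ∧ nine spine estimates (0/9 proved); BetaPertH ⇐ (D1) ∧ (D4) ∧ CAP+tail;
G-an2-4 gates asym, D1 and NE2/3/4.  HONEST FRAMING (cell contract, verbatim): «discharging `BetaPertH` makes Bałaban's UV stability UNCONDITIONAL —
a real constructive-QFT result; it is NOT the continuum limit and NOT the Clay problem.»  ABSOLUTE RULE (cell charter, verbatim): «No internally-minted
statement may enter as a cited fact. Every hypothesis is either kernel-proved in this package or a verbatim quotation of a PUBLISHED theorem with page
reference. The manuscript(s) under audit are NOT citable for their own disputed steps — they are the thing under adjudication; programme-internal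
(2001/route/tribunal) claims are never citable.»

WHAT ([folklore] finite sums ∕ period regrouping BY NAME over OUR typed objects; no `def`, no `def … : Prop`, nothing cited, 0 sorry): §5 the Λ-stencil against the two
gauge-mode families of the torus call (`sum_perZ_dper_SLam_mul_tgrad ∕ _mul_tgradBlock`) and **`torus_a1_lam`** (U21's `hD₁ hD₂` with generic column selections,
weight `w`, coefficient family `c` under `hc`): endpoint readings of the fluctuation bond MINUS of the coarse index bond, weighted by the periodised coefficients and
the (0.4) first-order kernel; §7 the bridge **`torus_Q10_levelZero_apply`** — U21's `hQ₁₀` VERBATIM: `Q₁₀ a v = Lc^{d+1} · Σ'_k symLinKerAt ρ_c Lc a.2 (a.1 + M′∘k) (v.2, v.1)`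
(an2's `bhKStepSh_zero`, an1's `bhK_add_Dsh_eq_ffK_sub_smul_mfNeg_linSym04At`, `lin04KerAt_eq_symLinKerAt`); §8 `tsum_coarse_regroup` and the headline
**`torus_a1_lam_Q10`**: `(Σ_b h b • (w • Λ_b|ff)) * fromCols D₂ D₁ = (w ∕ (2·Lc^{d+1})) • (of (v e ↦ (Q₁₀ᵀ Λ₁ʰ)_v · σ_e(v)) − Q₁₀ᵀ * of (a e ↦ Λ₁ʰ_a · σ^c_e(a)))`,
`Λ₁ʰ_a := Σ_b h b · c^per_b(a)`.  NOT HERE: the per-direction discharge of `a1` (`PeriodisedWardOrderOneCompanion`).  Discharges NO binder of row D1; 0 estimates;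
0∕4 row-D1 binders (hW, hR, D1Tel, D1Rep); NOT (J-a) complete, NOT (T-ID), NOT SDF, NOT D1, NEVER «G-an2-4 closed», NOT BetaPertH, NOT continuum, NOT Clay.
«not in print; our bookkeeping».  Unit `b2b-balaban-beta-d1-formalise-leaf-05` (gen 33 probe J15c §5–§8; gen 34 module), 2026-08-23; no existing file touched.
-/

noncomputable section

namespace Summit.QuantumFields.BalabanUV.Beta.FP.PeriodisedLamGaugeLegDoor

open scoped BigOperators Matrix
open Finset
open Literature.MathematicalPhysics.QuantumFieldTheory.Balaban1983to89
open Literature.MathematicalPhysics.QuantumFieldTheory.Balaban1983to89.Beta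
open B4TorusKernel.MultiPeriod (translate translate_apply)
open B6Lemma24Torus (pbox mem_pbox)
open ExpKernelCalculus (MKer shiftK)
open AffineAveraging (Site box toSite unitVec dz)
open AveragingHessianKernels (Near)
open OneStepResolventKernel (Fib)
open InterLevelTransport (SLam)
open Summit.QuantumFields.BalabanUV.Beta.SymAveragingHessianCounts (symHessFFAt symHessKerAt symHessFFAt_inl_inl symLinKerAt symHessFFAt_translate symLinKerAt_eq_zero)
open Summit.QuantumFields.BalabanUV.Beta.LinearGaugeVH (nearBox mem_nearBox summable_of_finsupp)
open Summit.QuantumFields.BalabanUV.Beta.GAN24.HessianGaugeLegContact (exists_finset_near)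
open Summit.QuantumFields.BalabanUV.Beta.FP.KernelPeriodisationFib (Idx perF perF_apply perZ perZ_apply)
open Summit.QuantumFields.BalabanUV.Beta.FP.KernelPeriodisationFibLoc (dper dper_apply)
open Summit.QuantumFields.BalabanUV.Beta.FP.KernelPeriodisationFibTrace (tsum_sites_eq_sum_tsum)
open Summit.QuantumFields.BalabanUV.Beta.FP.TorusGaugeCovariance (tdelta tdelta_translate tgrad tgrad_inl)
open Literature.MathematicalPhysics.QuantumFieldTheory.LatticeForm (quo)
open Summit.QuantumFields.BalabanUV.Beta.FP.TorusGaugeCovarianceCoarse (tgradBlock tgradBlock_inl tdelta_quo_congr)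
open B5Prop11Plancherel (fine)
open AveragingContours (blk off)
open AveragingContoursRooted (ctr ctrOff ctrOff_mem_box)
open OneStepResolventKernel (quo_zsmul)
open RootedKernelReflection (off_zsmul)
open StepJetData (mfNeg mfNeg_inr_inl)
open Summit.QuantumFields.BalabanUV.Beta.WardLocusStencils (ffK ffK_inr_inl)
open Summit.QuantumFields.BalabanUV.Beta.BorderedHessian (bhK blk_eq_quo)
open Summit.QuantumFields.BalabanUV.Beta.DshAn1 (Dsh linSym04At lin04KerAt linSym04At_inr_inl bhK_add_Dsh_eq_ffK_sub_smul_mfNeg_linSym04At)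
open Summit.QuantumFields.BalabanUV.Beta.SymAveragingWardRootedStencils (lin04KerAt_eq_symLinKerAt)
open Summit.QuantumFields.BalabanUV.Beta.SymShiftedSpread (bhKStepSh bhKStepSh_zero)
open Summit.QuantumFields.BalabanUV.Beta.FP.TorusGaugeCovarianceCoarse (coarsePt coarsePt_coe)
open Summit.QuantumFields.BalabanUV.Beta.SymAveragingHessianCounts (symLinKerAt_add)
open Summit.QuantumFields.BalabanUV.Beta.FP.PeriodisedLamGaugeLeg (sum_perZ_dper_SLam_symHessFFAt_mul_grad_periodic sum_perZ_dper_SLam_mul_tgrad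
  sum_perZ_dper_SLam_mul_tgradBlock)

variable {d : ℕ}

/-! ## §5∕§6 The two gauge-mode families of the torus call are `PeriodisedLamGaugeLeg.sum_perZ_dper_SLam_mul_tgrad ∕ _mul_tgradBlock` (imported BY NAME) -/

section Modes

variable (M' : Fin (d + 1) → ℕ) [∀ μ, NeZero (M' μ)] (Lc : ℕ) [NeZero Lc]

/-! ## §6 THE Λ HALF OF THE LEVEL-0 DOOR's WARD ROW `a1` IN CLOSED FORM (U21's binders `hD₁ hD₂` with the column selections generic, the Λ term of
U21's `hH₁` with the weight `w` and the coefficient family `c` generic — at the record `c = lamCoeffOf KInv Lc`, `w = −(2cΛ)∕Lc⁸`) -/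

/-- **J15-a1Λ — THE Λ SECTOR OF `a1` IN CLOSED FORM**: on `F = fine Lc M′`, box root `toSite r` (`r ∈ box (d+1) Lc`), for any bond weight `h`, any `w`,
any coefficient family summable along the fine-period copies,
`(Σ_b h b • (w • Λ_b|ff)) * fromCols D₂ D₁ = w • of (v e ↦ Σ_b h b · Σ_μ Σ'_y c^per_b(μ,y) · ((σ_e(v) − σ_e^c(μ,y)) · q¹_{(μ,y)}(v) ∕ 2))`:
the column potential read at the two endpoints of the fluctuation bond `v` (`σ_e(v)`, as in J11) MINUS at the two endpoints of the coarse index bond `(μ,y)`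
(`σ^c_e(μ,y)`), weighted by the periodised conversion coefficients and the (0.4) first-order kernel. -/
theorem torus_a1_lam {r : Fin (d + 1) → ℕ} (hr : r ∈ box (d + 1) Lc)
    {γ₁ γ₂ : Type*} [Fintype γ₁] [Fintype γ₂] (g₁ : γ₁ → ↥(pbox (fine Lc M'))) (g₂ : γ₂ → ↥(pbox M')) (w : ℝ)
    (h : ↥(pbox (fine Lc M')) × Fin (d + 1) → ℝ) (c : Fin (d + 1) → Site (d + 1) → Fin (d + 1) → Site (d + 1) → ℝ)
    (hc : ∀ κ' u μ y, Summable fun m : Site (d + 1) => c μ (translate M' y m) κ' u)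
    {D₁ : Matrix (↥(pbox (fine Lc M')) × Fin (d + 1)) γ₁ ℝ}
    (hD₁ : D₁ = (tgrad (fine Lc M')).submatrix (fun b : ↥(pbox (fine Lc M')) × Fin (d + 1) => ((b.1, Sum.inl b.2) : Idx (fine Lc M') (Fib d))) g₁)
    {D₂ : Matrix (↥(pbox (fine Lc M')) × Fin (d + 1)) γ₂ ℝ}
    (hD₂ : D₂ = (tgradBlock M' Lc).submatrix (fun b : ↥(pbox (fine Lc M')) × Fin (d + 1) => ((b.1, Sum.inl b.2) : Idx (fine Lc M') (Fib d))) g₂) :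
    (∑ b : ↥(pbox (fine Lc M')) × Fin (d + 1), h b •
          (w • (perF (fine Lc M') (dper (fine Lc M')
              (SLam Lc c (fun μ y => symHessFFAt (toSite r) Lc μ y) b.2 (b.1 : Site (d + 1))))).submatrix
            (fun b : ↥(pbox (fine Lc M')) × Fin (d + 1) => ((b.1, Sum.inl b.2) : Idx (fine Lc M') (Fib d)))
            (fun b : ↥(pbox (fine Lc M')) × Fin (d + 1) => ((b.1, Sum.inl b.2) : Idx (fine Lc M') (Fib d)))))
        * Matrix.fromCols D₂ D₁
      = w • Matrix.of (fun (v : ↥(pbox (fine Lc M')) × Fin (d + 1)) (e : γ₂ ⊕ γ₁) =>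
          ∑ b : ↥(pbox (fine Lc M')) × Fin (d + 1), h b *
            ∑ μ : Fin (d + 1), ∑' y : Site (d + 1), (∑' m : Site (d + 1), c μ (translate M' y m) b.2 (b.1 : Site (d + 1))) *
              ((Sum.elim (fun (t : γ₂) (z : Site (d + 1)) => tdelta M' (quo Lc z) (g₂ t)) (fun (s : γ₁) (z : Site (d + 1)) => tdelta (fine Lc M') z (g₁ s)) e
                    (v.1 : Site (d + 1))
                + Sum.elim (fun (t : γ₂) (z : Site (d + 1)) => tdelta M' (quo Lc z) (g₂ t)) (fun (s : γ₁) (z : Site (d + 1)) => tdelta (fine Lc M') z (g₁ s)) e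
                    ((v.1 : Site (d + 1)) + unitVec v.2)
                - Sum.elim (fun (t : γ₂) (z : Site (d + 1)) => tdelta M' (quo Lc z) (g₂ t)) (fun (s : γ₁) (z : Site (d + 1)) => tdelta (fine Lc M') z (g₁ s)) e
                    ((Lc : ℤ) • y + toSite r)
                - Sum.elim (fun (t : γ₂) (z : Site (d + 1)) => tdelta M' (quo Lc z) (g₂ t)) (fun (s : γ₁) (z : Site (d + 1)) => tdelta (fine Lc M') z (g₁ s)) e
                    ((Lc : ℤ) • y + toSite r + (Lc : ℤ) • unitVec μ))
                * symLinKerAt (toSite r) Lc μ y (v.2, (v.1 : Site (d + 1))) / 2)) := by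
  have hLD₂ : ∀ (b v : ↥(pbox (fine Lc M')) × Fin (d + 1)) (t : γ₂),
      ((perF (fine Lc M') (dper (fine Lc M') (SLam Lc c (fun μ y => symHessFFAt (toSite r) Lc μ y) b.2 (b.1 : Site (d + 1))))).submatrix
            (fun b : ↥(pbox (fine Lc M')) × Fin (d + 1) => ((b.1, Sum.inl b.2) : Idx (fine Lc M') (Fib d)))
            (fun b : ↥(pbox (fine Lc M')) × Fin (d + 1) => ((b.1, Sum.inl b.2) : Idx (fine Lc M') (Fib d))) * D₂) v t
        = ∑ μ : Fin (d + 1), ∑' y : Site (d + 1), (∑' m : Site (d + 1), c μ (translate M' y m) b.2 (b.1 : Site (d + 1))) *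
          ((tdelta M' (quo Lc (v.1 : Site (d + 1))) (g₂ t) + tdelta M' (quo Lc ((v.1 : Site (d + 1)) + unitVec v.2)) (g₂ t)
              - tdelta M' (quo Lc ((Lc : ℤ) • y + toSite r)) (g₂ t) - tdelta M' (quo Lc ((Lc : ℤ) • y + toSite r + (Lc : ℤ) • unitVec μ)) (g₂ t))
            * symLinKerAt (toSite r) Lc μ y (v.2, (v.1 : Site (d + 1))) / 2) := fun b v t => by
    rw [hD₂, Matrix.mul_apply, Fintype.sum_prod_type]
    simp only [Matrix.submatrix_apply, perF_apply]
    exact sum_perZ_dper_SLam_mul_tgradBlock M' Lc hr c b.2 (b.1 : Site (d + 1)) (hc b.2 _) (v.1 : Site (d + 1)) v.2 (g₂ t)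
  have hLD₁ : ∀ (b v : ↥(pbox (fine Lc M')) × Fin (d + 1)) (s : γ₁),
      ((perF (fine Lc M') (dper (fine Lc M') (SLam Lc c (fun μ y => symHessFFAt (toSite r) Lc μ y) b.2 (b.1 : Site (d + 1))))).submatrix
            (fun b : ↥(pbox (fine Lc M')) × Fin (d + 1) => ((b.1, Sum.inl b.2) : Idx (fine Lc M') (Fib d)))
            (fun b : ↥(pbox (fine Lc M')) × Fin (d + 1) => ((b.1, Sum.inl b.2) : Idx (fine Lc M') (Fib d))) * D₁) v s
        = ∑ μ : Fin (d + 1), ∑' y : Site (d + 1), (∑' m : Site (d + 1), c μ (translate M' y m) b.2 (b.1 : Site (d + 1))) *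
          ((tdelta (fine Lc M') (v.1 : Site (d + 1)) (g₁ s) + tdelta (fine Lc M') ((v.1 : Site (d + 1)) + unitVec v.2) (g₁ s)
              - tdelta (fine Lc M') ((Lc : ℤ) • y + toSite r) (g₁ s) - tdelta (fine Lc M') ((Lc : ℤ) • y + toSite r + (Lc : ℤ) • unitVec μ) (g₁ s))
            * symLinKerAt (toSite r) Lc μ y (v.2, (v.1 : Site (d + 1))) / 2) := fun b v s => by
    rw [hD₁, Matrix.mul_apply, Fintype.sum_prod_type]
    simp only [Matrix.submatrix_apply, perF_apply]
    exact sum_perZ_dper_SLam_mul_tgrad M' Lc hr c b.2 (b.1 : Site (d + 1)) (hc b.2 _) (v.1 : Site (d + 1)) v.2 (g₁ s)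
  rw [Matrix.mul_fromCols]
  ext v e
  rw [Matrix.smul_apply, Matrix.of_apply]
  cases e with
  | inl t =>
      rw [Matrix.fromCols_apply_inl, Matrix.sum_mul, Matrix.sum_apply]
      simp only [Matrix.smul_mul, Matrix.smul_apply, hLD₂, smul_eq_mul, Sum.elim_inl]
      rw [Finset.mul_sum]
      refine Finset.sum_congr rfl fun b _ => ?_
      ring
  | inr s =>
      rw [Matrix.fromCols_apply_inr, Matrix.sum_mul, Matrix.sum_apply]
      simp only [Matrix.smul_mul, Matrix.smul_apply, hLD₁, smul_eq_mul, Sum.elim_inr]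
      rw [Finset.mul_sum]
      refine Finset.sum_congr rfl fun b _ => ?_
      ring

end Modes



/-! ## §7 THE DICTIONARY BRIDGE: U21's averaging row `Q₁₀` (level 0, `bhKStepSh d Lc (Dsh Lc) 0`, coarse slot `(coarsePt M′ Lc a.1, inr a.2)`) IS
`Lc^{d+1} ·` the period sum of the (0.4) first-order kernel `symLinKerAt (ctr (d+1) Lc) Lc` — the weight of §2∕§6 -/

section Bridge

variable (M' : Fin (d + 1) → ℕ) [∀ μ, NeZero (M' μ)] (Lc : ℕ) [NeZero Lc]

omit [∀ μ, NeZero (M' μ)] [NeZero Lc] in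
/-- [folklore] the period sum of the first-order kernel over the COARSE copies of the index bond equals the period sum over the FINE copies of the
fluctuation bond (`symLinKerAt_add`, re-indexing `k ↦ −k`). -/
theorem tsum_symLinKerAt_copies (ρ : Site (d + 1)) (μ : Fin (d + 1)) (y x : Site (d + 1)) (α : Fin (d + 1)) :
    ∑' k : Site (d + 1), symLinKerAt ρ Lc μ (translate M' y k) (α, x)
      = ∑' m : Site (d + 1), symLinKerAt ρ Lc μ y (α, translate (fine Lc M') x m) := by
  rw [← (Equiv.neg (Site (d + 1))).tsum_eq (fun m => symLinKerAt ρ Lc μ y (α, translate (fine Lc M') x m))]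
  refine tsum_congr fun k => ?_
  simp only [Equiv.neg_apply]
  rw [← symLinKerAt_add ρ Lc μ y (fun i => (M' i : ℤ) * k i) (α, translate (fine Lc M') x (-k))]
  have e1 : translate M' y k = y + (fun i => (M' i : ℤ) * k i) := by
    funext i; simp only [translate_apply, Pi.add_apply]
  have e2 : AveragingHessianKernels.Bond.sh ((α, translate (fine Lc M') x (-k)) : Fin (d + 1) × Site (d + 1))
      ((Lc : ℤ) • (fun i => (M' i : ℤ) * k i)) = (α, x) := by
    show ((α, translate (fine Lc M') x (-k) + (Lc : ℤ) • (fun i => (M' i : ℤ) * k i)) : Fin (d + 1) × Site (d + 1)) = (α, x)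
    refine Prod.ext rfl ?_
    funext i
    simp only [Pi.add_apply, translate_apply, Pi.neg_apply, Pi.smul_apply, smul_eq_mul, fine]
    push_cast
    ring
  rw [e1, e2]

omit [∀ μ, NeZero (M' μ)] in
/-- [folklore] **`Q₁₀ = Lc^{d+1} · q̃`** — U21's level-0 averaging row (binder `hQ₁₀` VERBATIM, generic `d`) entrywise:
`Q₁₀ a v = Lc^{d+1} · Σ'_k symLinKerAt (ctr (d+1) Lc) Lc a.2 (a.1 + M′∘k) (v.2, v.1)` (`bhKStepSh_zero`, an1's `bhK_add_Dsh_eq_ffK_sub_smul_mfNeg_linSym04At`,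
`linSym04At_inr_inl` on the coarse sublattice, `lin04KerAt_eq_symLinKerAt`, `tsum_symLinKerAt_copies`). -/
theorem torus_Q10_levelZero_apply
    {Q₁₀ : Matrix (↥(pbox M') × Fin (d + 1)) (↥(pbox (fine Lc M')) × Fin (d + 1)) ℝ}
    (hQ₁₀ : Q₁₀ = (perF (fine Lc M') (bhKStepSh d Lc (Dsh Lc) 0)).submatrix
        (fun a : ↥(pbox M') × Fin (d + 1) => ((coarsePt M' Lc a.1, Sum.inr a.2) : Idx (fine Lc M') (Fib d)))
        (fun b : ↥(pbox (fine Lc M')) × Fin (d + 1) => ((b.1, Sum.inl b.2) : Idx (fine Lc M') (Fib d))))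
    (a : ↥(pbox M') × Fin (d + 1)) (v : ↥(pbox (fine Lc M')) × Fin (d + 1)) :
    Q₁₀ a v = (Lc : ℝ) ^ (d + 1) *
      ∑' k : Site (d + 1), symLinKerAt (ctr (d + 1) Lc) Lc a.2 (translate M' (a.1 : Site (d + 1)) k) (v.2, (v.1 : Site (d + 1))) := by
  rw [hQ₁₀, Matrix.submatrix_apply, perF_apply, perZ_apply, tsum_symLinKerAt_copies M' Lc, ← tsum_mul_left]
  refine tsum_congr fun m => ?_
  rw [bhKStepSh_zero, bhK_add_Dsh_eq_ffK_sub_smul_mfNeg_linSym04At]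
  simp only [Pi.sub_apply, Pi.smul_apply, smul_eq_mul, ffK_inr_inl, mfNeg_inr_inl, linSym04At_inr_inl, coarsePt_coe]
  rw [off_zsmul, if_pos rfl, blk_eq_quo, quo_zsmul, lin04KerAt_eq_symLinKerAt]
  ring

end Bridge



/-! ## §8a finite bookkeeping -/

/-- [folklore] a triple finite sum reordered: `Σ_x Σ_{x1} Σ_{y0} f = Σ_{y0} Σ_{x1} Σ_x f`. -/
theorem comm3 {ι κ ν : Type*} [Fintype ι] [Fintype κ] [Fintype ν] (f : ι → ν → κ → ℝ) :
    (∑ x, ∑ x1, ∑ y0, f x x1 y0) = ∑ y0, ∑ x1, ∑ x, f x x1 y0 := by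
  calc (∑ x, ∑ x1, ∑ y0, f x x1 y0) = ∑ x1, ∑ x, ∑ y0, f x x1 y0 := Finset.sum_comm
    _ = ∑ x1, ∑ y0, ∑ x, f x x1 y0 := Finset.sum_congr rfl fun x1 _ => Finset.sum_comm
    _ = ∑ y0, ∑ x1, ∑ x, f x x1 y0 := Finset.sum_comm

/-- finite bookkeeping for `torus_a1_lam_Q10`. -/
theorem bookkeeping {ι κ ν : Type*} [Fintype ι] [Fintype κ] [Fintype ν] (w L2 Ra Rb : ℝ) (h : ι → ℝ) (CP : ν → κ → ι → ℝ)
    (P1 : κ → ℝ) (P2 : κ → ν → ℝ) (Q : κ × ν → ℝ) :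
    w * ∑ x, h x * ∑ x_1, ∑ y₀, CP x_1 y₀ x * (Ra + Rb - P1 y₀ - P2 y₀ x_1) * Q (y₀, x_1) / L2
      = w / L2 * ((∑ a, Q a * ∑ b, h b * CP a.2 a.1 b) * (Ra + Rb) - ∑ x, Q x * ((∑ b, h b * CP x.2 x.1 b) * (P1 x.1 + P2 x.1 x.2))) := by
  have eL : w * ∑ x, h x * ∑ x_1, ∑ y₀, CP x_1 y₀ x * (Ra + Rb - P1 y₀ - P2 y₀ x_1) * Q (y₀, x_1) / L2
      = ∑ y₀, ∑ x_1, ∑ x, w * (h x * (CP x_1 y₀ x * (Ra + Rb - P1 y₀ - P2 y₀ x_1) * Q (y₀, x_1) / L2)) := by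
    rw [← comm3]
    simp only [Finset.mul_sum]
  have eR : w / L2 * ((∑ a, Q a * ∑ b, h b * CP a.2 a.1 b) * (Ra + Rb) - ∑ x, Q x * ((∑ b, h b * CP x.2 x.1 b) * (P1 x.1 + P2 x.1 x.2)))
      = ∑ y₀, ∑ x_1, ∑ x, w / L2 * (Q (y₀, x_1) * (h x * CP x_1 y₀ x) * (Ra + Rb) - Q (y₀, x_1) * (h x * CP x_1 y₀ x * (P1 y₀ + P2 y₀ x_1))) := by
    rw [Fintype.sum_prod_type, Fintype.sum_prod_type]
    simp only [Finset.mul_sum, Finset.sum_mul, mul_sub, Finset.sum_sub_distrib]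
  rw [eL, eR]
  refine Finset.sum_congr rfl fun y₀ _ => Finset.sum_congr rfl fun x_1 _ => Finset.sum_congr rfl fun x _ => ?_
  ring


/-! ## §8 THE Λ HALF OF `a1` IN U21's OWN AVERAGING ROW `Q₁₀` (the period sums regrouped over the coarse torus; `hQ₁₀` VERBATIM, root `ctr (d+1) Lc`) -/

section Regroup

variable (M' : Fin (d + 1) → ℕ) [∀ μ, NeZero (M' μ)] (Lc : ℕ) [NeZero Lc]

omit [∀ μ, NeZero (M' μ)] [NeZero Lc] in
/-- [folklore] the fine-periodised coefficients are `M′`-periodic in the coarse index. -/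
theorem cper_translate (c : Fin (d + 1) → Site (d + 1) → Fin (d + 1) → Site (d + 1) → ℝ) (μ : Fin (d + 1)) (y k : Site (d + 1))
    (κ' : Fin (d + 1)) (u : Site (d + 1)) :
    ∑' m : Site (d + 1), c μ (translate M' (translate M' y k) m) κ' u = ∑' m : Site (d + 1), c μ (translate M' y m) κ' u := by
  simp only [B4Reflection242.translate_translate]
  exact (Equiv.addLeft k).tsum_eq (fun m => c μ (translate M' y m) κ' u)

omit [∀ μ, NeZero (M' μ)] in
/-- [folklore] the column potentials of both gauge-mode families are `F`-periodic (`F = fine Lc M′`). -/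
theorem colPot_translate {γ₁ γ₂ : Type*} (g₁ : γ₁ → ↥(pbox (fine Lc M'))) (g₂ : γ₂ → ↥(pbox M')) (e : γ₂ ⊕ γ₁) (z k : Site (d + 1)) :
    Sum.elim (fun (t : γ₂) (z : Site (d + 1)) => tdelta M' (quo Lc z) (g₂ t)) (fun (s : γ₁) (z : Site (d + 1)) => tdelta (fine Lc M') z (g₁ s)) e
        (translate (fine Lc M') z k)
      = Sum.elim (fun (t : γ₂) (z : Site (d + 1)) => tdelta M' (quo Lc z) (g₂ t)) (fun (s : γ₁) (z : Site (d + 1)) => tdelta (fine Lc M') z (g₁ s)) e z := by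
  cases e with
  | inl t =>
      simp only [Sum.elim_inl]
      refine tdelta_quo_congr M' Lc (fun i => ⟨k i, ?_⟩) (g₂ t)
      simp only [translate_apply, fine]
      push_cast
      ring
  | inr s =>
      simp only [Sum.elim_inr]
      exact tdelta_translate (fine Lc M') z k (g₁ s)

omit [∀ μ, NeZero (M' μ)] [NeZero Lc] in
/-- [folklore] the endpoints of the coarse copies of a coarse bond are the fine copies of its endpoints. -/
theorem coarseEnd_translate (ρ : Site (d + 1)) (y k : Site (d + 1)) (v : Site (d + 1)) :
    (Lc : ℤ) • translate M' y k + ρ + v = translate (fine Lc M') ((Lc : ℤ) • y + ρ + v) k := by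
  funext i; simp only [translate_apply, Pi.add_apply, Pi.smul_apply, smul_eq_mul, fine]; push_cast; ring

/-- [folklore] **THE COARSE PERIOD SUM REGROUPED**: for fixed `v e μ` and a coefficient row, the sum over ALL coarse sites `y` of
`c^per(μ,y) · (σ_e(v) − σ^c_e(μ,y)) · q¹_{(μ,y)}(v) ∕ 2` is the sum over the coarse TORUS of `c^per(μ,y₀) · (σ_e(v) − σ^c_e(μ,y₀)) · Q₁₀ (y₀,μ) v ∕ (2·Lc^{d+1})`. -/
theorem tsum_coarse_regroup
    {Q₁₀ : Matrix (↥(pbox M') × Fin (d + 1)) (↥(pbox (fine Lc M')) × Fin (d + 1)) ℝ}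
    (hQ₁₀ : Q₁₀ = (perF (fine Lc M') (bhKStepSh d Lc (Dsh Lc) 0)).submatrix
        (fun a : ↥(pbox M') × Fin (d + 1) => ((coarsePt M' Lc a.1, Sum.inr a.2) : Idx (fine Lc M') (Fib d)))
        (fun b : ↥(pbox (fine Lc M')) × Fin (d + 1) => ((b.1, Sum.inl b.2) : Idx (fine Lc M') (Fib d))))
    {γ₁ γ₂ : Type*} (g₁ : γ₁ → ↥(pbox (fine Lc M'))) (g₂ : γ₂ → ↥(pbox M'))
    (c : Fin (d + 1) → Site (d + 1) → Fin (d + 1) → Site (d + 1) → ℝ) (κ' : Fin (d + 1)) (u : Site (d + 1)) (μ : Fin (d + 1))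
    (v : ↥(pbox (fine Lc M')) × Fin (d + 1)) (e : γ₂ ⊕ γ₁) :
    ∑' y : Site (d + 1), (∑' m : Site (d + 1), c μ (translate M' y m) κ' u) *
        (((Sum.elim (fun (t : γ₂) (z : Site (d + 1)) => tdelta M' (quo Lc z) (g₂ t)) (fun (s : γ₁) (z : Site (d + 1)) => tdelta (fine Lc M') z (g₁ s)) e) (v.1 : Site (d + 1)) + (Sum.elim (fun (t : γ₂) (z : Site (d + 1)) => tdelta M' (quo Lc z) (g₂ t)) (fun (s : γ₁) (z : Site (d + 1)) => tdelta (fine Lc M') z (g₁ s)) e) ((v.1 : Site (d + 1)) + unitVec v.2)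
            - (Sum.elim (fun (t : γ₂) (z : Site (d + 1)) => tdelta M' (quo Lc z) (g₂ t)) (fun (s : γ₁) (z : Site (d + 1)) => tdelta (fine Lc M') z (g₁ s)) e) ((Lc : ℤ) • y + toSite (ctrOff (d + 1) Lc)) - (Sum.elim (fun (t : γ₂) (z : Site (d + 1)) => tdelta M' (quo Lc z) (g₂ t)) (fun (s : γ₁) (z : Site (d + 1)) => tdelta (fine Lc M') z (g₁ s)) e) ((Lc : ℤ) • y + toSite (ctrOff (d + 1) Lc) + (Lc : ℤ) • unitVec μ))
          * symLinKerAt (toSite (ctrOff (d + 1) Lc)) Lc μ y (v.2, (v.1 : Site (d + 1))) / 2)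
      = ∑ y₀ : ↥(pbox M'), (∑' m : Site (d + 1), c μ (translate M' (y₀ : Site (d + 1)) m) κ' u) *
          ((Sum.elim (fun (t : γ₂) (z : Site (d + 1)) => tdelta M' (quo Lc z) (g₂ t)) (fun (s : γ₁) (z : Site (d + 1)) => tdelta (fine Lc M') z (g₁ s)) e) (v.1 : Site (d + 1)) + (Sum.elim (fun (t : γ₂) (z : Site (d + 1)) => tdelta M' (quo Lc z) (g₂ t)) (fun (s : γ₁) (z : Site (d + 1)) => tdelta (fine Lc M') z (g₁ s)) e) ((v.1 : Site (d + 1)) + unitVec v.2)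
            - (Sum.elim (fun (t : γ₂) (z : Site (d + 1)) => tdelta M' (quo Lc z) (g₂ t)) (fun (s : γ₁) (z : Site (d + 1)) => tdelta (fine Lc M') z (g₁ s)) e) ((Lc : ℤ) • (y₀ : Site (d + 1)) + toSite (ctrOff (d + 1) Lc))
            - (Sum.elim (fun (t : γ₂) (z : Site (d + 1)) => tdelta M' (quo Lc z) (g₂ t)) (fun (s : γ₁) (z : Site (d + 1)) => tdelta (fine Lc M') z (g₁ s)) e) ((Lc : ℤ) • (y₀ : Site (d + 1)) + toSite (ctrOff (d + 1) Lc) + (Lc : ℤ) • unitVec μ))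
          * Q₁₀ (y₀, μ) v / (2 * (Lc : ℝ) ^ (d + 1)) := by
  classical
  have hLc1 : 1 ≤ Lc := Nat.one_le_iff_ne_zero.mpr (NeZero.ne Lc)
  have hLc0 : ((Lc : ℝ) ^ (d + 1)) ≠ 0 := pow_ne_zero _ (Nat.cast_ne_zero.2 (NeZero.ne Lc))
  have hr := ctrOff_mem_box (d := d + 1) hLc1
  -- the summand is finitely supported in `y` (the kernel vanishes off the coarse bonds near `v.1`)
  obtain ⟨s, hs⟩ := exists_finset_near (d := d) hLc1 (v.1 : Site (d + 1))
  have hsumm : Summable fun y : Site (d + 1) => (∑' m : Site (d + 1), c μ (translate M' y m) κ' u) *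
      (((Sum.elim (fun (t : γ₂) (z : Site (d + 1)) => tdelta M' (quo Lc z) (g₂ t)) (fun (s : γ₁) (z : Site (d + 1)) => tdelta (fine Lc M') z (g₁ s)) e) (v.1 : Site (d + 1)) + (Sum.elim (fun (t : γ₂) (z : Site (d + 1)) => tdelta M' (quo Lc z) (g₂ t)) (fun (s : γ₁) (z : Site (d + 1)) => tdelta (fine Lc M') z (g₁ s)) e) ((v.1 : Site (d + 1)) + unitVec v.2)
          - (Sum.elim (fun (t : γ₂) (z : Site (d + 1)) => tdelta M' (quo Lc z) (g₂ t)) (fun (s : γ₁) (z : Site (d + 1)) => tdelta (fine Lc M') z (g₁ s)) e) ((Lc : ℤ) • y + toSite (ctrOff (d + 1) Lc)) - (Sum.elim (fun (t : γ₂) (z : Site (d + 1)) => tdelta M' (quo Lc z) (g₂ t)) (fun (s : γ₁) (z : Site (d + 1)) => tdelta (fine Lc M') z (g₁ s)) e) ((Lc : ℤ) • y + toSite (ctrOff (d + 1) Lc) + (Lc : ℤ) • unitVec μ))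
        * symLinKerAt (toSite (ctrOff (d + 1) Lc)) Lc μ y (v.2, (v.1 : Site (d + 1))) / 2) :=
    summable_of_finsupp s fun y hy => by
      rw [symLinKerAt_eq_zero hr (f := (v.2, (v.1 : Site (d + 1)))) (fun hn => hy (hs y hn))]
      ring
  rw [tsum_sites_eq_sum_tsum M' hsumm]
  refine Finset.sum_congr rfl fun y₀ _ => ?_
  have per : ∀ k : Site (d + 1),
      (∑' m : Site (d + 1), c μ (translate M' (translate M' (y₀ : Site (d + 1)) k) m) κ' u) *
        (((Sum.elim (fun (t : γ₂) (z : Site (d + 1)) => tdelta M' (quo Lc z) (g₂ t)) (fun (s : γ₁) (z : Site (d + 1)) => tdelta (fine Lc M') z (g₁ s)) e) (v.1 : Site (d + 1)) + (Sum.elim (fun (t : γ₂) (z : Site (d + 1)) => tdelta M' (quo Lc z) (g₂ t)) (fun (s : γ₁) (z : Site (d + 1)) => tdelta (fine Lc M') z (g₁ s)) e) ((v.1 : Site (d + 1)) + unitVec v.2)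
            - (Sum.elim (fun (t : γ₂) (z : Site (d + 1)) => tdelta M' (quo Lc z) (g₂ t)) (fun (s : γ₁) (z : Site (d + 1)) => tdelta (fine Lc M') z (g₁ s)) e) ((Lc : ℤ) • translate M' (y₀ : Site (d + 1)) k + toSite (ctrOff (d + 1) Lc))
            - (Sum.elim (fun (t : γ₂) (z : Site (d + 1)) => tdelta M' (quo Lc z) (g₂ t)) (fun (s : γ₁) (z : Site (d + 1)) => tdelta (fine Lc M') z (g₁ s)) e) ((Lc : ℤ) • translate M' (y₀ : Site (d + 1)) k + toSite (ctrOff (d + 1) Lc) + (Lc : ℤ) • unitVec μ))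
          * symLinKerAt (toSite (ctrOff (d + 1) Lc)) Lc μ (translate M' (y₀ : Site (d + 1)) k) (v.2, (v.1 : Site (d + 1))) / 2)
      = ((∑' m : Site (d + 1), c μ (translate M' (y₀ : Site (d + 1)) m) κ' u) *
          ((Sum.elim (fun (t : γ₂) (z : Site (d + 1)) => tdelta M' (quo Lc z) (g₂ t)) (fun (s : γ₁) (z : Site (d + 1)) => tdelta (fine Lc M') z (g₁ s)) e) (v.1 : Site (d + 1)) + (Sum.elim (fun (t : γ₂) (z : Site (d + 1)) => tdelta M' (quo Lc z) (g₂ t)) (fun (s : γ₁) (z : Site (d + 1)) => tdelta (fine Lc M') z (g₁ s)) e) ((v.1 : Site (d + 1)) + unitVec v.2)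
            - (Sum.elim (fun (t : γ₂) (z : Site (d + 1)) => tdelta M' (quo Lc z) (g₂ t)) (fun (s : γ₁) (z : Site (d + 1)) => tdelta (fine Lc M') z (g₁ s)) e) ((Lc : ℤ) • (y₀ : Site (d + 1)) + toSite (ctrOff (d + 1) Lc))
            - (Sum.elim (fun (t : γ₂) (z : Site (d + 1)) => tdelta M' (quo Lc z) (g₂ t)) (fun (s : γ₁) (z : Site (d + 1)) => tdelta (fine Lc M') z (g₁ s)) e) ((Lc : ℤ) • (y₀ : Site (d + 1)) + toSite (ctrOff (d + 1) Lc) + (Lc : ℤ) • unitVec μ)) / 2)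
        * symLinKerAt (toSite (ctrOff (d + 1) Lc)) Lc μ (translate M' (y₀ : Site (d + 1)) k) (v.2, (v.1 : Site (d + 1))) := fun k => by
    have e1 : (Lc : ℤ) • translate M' (y₀ : Site (d + 1)) k + toSite (ctrOff (d + 1) Lc)
        = translate (fine Lc M') ((Lc : ℤ) • (y₀ : Site (d + 1)) + toSite (ctrOff (d + 1) Lc)) k := by
      have h := coarseEnd_translate M' Lc (toSite (ctrOff (d + 1) Lc)) (y₀ : Site (d + 1)) k 0
      simpa only [add_zero] using h
    rw [cper_translate M' c μ (y₀ : Site (d + 1)) k κ' u, coarseEnd_translate M' Lc, e1, colPot_translate M' Lc g₁ g₂,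
      colPot_translate M' Lc g₁ g₂]
    ring
  have hq : ∑' k : Site (d + 1), symLinKerAt (toSite (ctrOff (d + 1) Lc)) Lc μ (translate M' (y₀ : Site (d + 1)) k) (v.2, (v.1 : Site (d + 1)))
      = Q₁₀ (y₀, μ) v / (Lc : ℝ) ^ (d + 1) := by
    rw [eq_div_iff hLc0, torus_Q10_levelZero_apply M' Lc hQ₁₀ (y₀, μ) v]
    show _ = (Lc : ℝ) ^ (d + 1) *
      ∑' k : Site (d + 1), symLinKerAt (toSite (ctrOff (d + 1) Lc)) Lc μ (translate M' (y₀ : Site (d + 1)) k) (v.2, (v.1 : Site (d + 1)))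
    ring
  rw [tsum_congr per, tsum_mul_left, hq]
  field_simp

/-- **J15-a1Λ-Q — THE Λ SECTOR OF `a1` IN U21's OWN LETTERS**: on `F = fine Lc M′`, root `ctr (d+1) Lc`, for any bond weight `h`, any `w`, any coefficient
family summable along the fine-period copies, and U21's `Q₁₀ D₁ D₂` VERBATIM,
`(Σ_b h b • (w • Λ_b|ff)) * fromCols D₂ D₁ = (w ∕ (2·Lc^{d+1})) • (of (v e ↦ (Q₁₀ᵀ Λ₁ʰ)_v · σ_e(v)) − Q₁₀ᵀ * of (a e ↦ Λ₁ʰ_a · σ^c_e(a)))`,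
`Λ₁ʰ_a := Σ_b h b · c^per_b(a.2, a.1)` (the direction's periodised multiplier jet), `σ_e(v)` = the column potential at the two endpoints of the fluctuation bond `v`,
`σ^c_e(a)` = at the two endpoints of the coarse bond `a` (as fine points from the root).  The FIRST term is DIAGONAL in `v` — the same reading as J11's
`−(c∕2)·(H₀h)_v·σ_e(v)` —, the SECOND lies in the range of `Q₁₀ᵀ`. -/
theorem torus_a1_lam_Q10
    {Q₁₀ : Matrix (↥(pbox M') × Fin (d + 1)) (↥(pbox (fine Lc M')) × Fin (d + 1)) ℝ}
    (hQ₁₀ : Q₁₀ = (perF (fine Lc M') (bhKStepSh d Lc (Dsh Lc) 0)).submatrix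
        (fun a : ↥(pbox M') × Fin (d + 1) => ((coarsePt M' Lc a.1, Sum.inr a.2) : Idx (fine Lc M') (Fib d)))
        (fun b : ↥(pbox (fine Lc M')) × Fin (d + 1) => ((b.1, Sum.inl b.2) : Idx (fine Lc M') (Fib d))))
    {γ₁ γ₂ : Type*} [Fintype γ₁] [Fintype γ₂] (g₁ : γ₁ → ↥(pbox (fine Lc M'))) (g₂ : γ₂ → ↥(pbox M')) (w : ℝ)
    (h : ↥(pbox (fine Lc M')) × Fin (d + 1) → ℝ) (c : Fin (d + 1) → Site (d + 1) → Fin (d + 1) → Site (d + 1) → ℝ)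
    (hc : ∀ κ' u μ y, Summable fun m : Site (d + 1) => c μ (translate M' y m) κ' u)
    {D₁ : Matrix (↥(pbox (fine Lc M')) × Fin (d + 1)) γ₁ ℝ}
    (hD₁ : D₁ = (tgrad (fine Lc M')).submatrix (fun b : ↥(pbox (fine Lc M')) × Fin (d + 1) => ((b.1, Sum.inl b.2) : Idx (fine Lc M') (Fib d))) g₁)
    {D₂ : Matrix (↥(pbox (fine Lc M')) × Fin (d + 1)) γ₂ ℝ}
    (hD₂ : D₂ = (tgradBlock M' Lc).submatrix (fun b : ↥(pbox (fine Lc M')) × Fin (d + 1) => ((b.1, Sum.inl b.2) : Idx (fine Lc M') (Fib d))) g₂) :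
    (∑ b : ↥(pbox (fine Lc M')) × Fin (d + 1), h b •
          (w • (perF (fine Lc M') (dper (fine Lc M')
              (SLam Lc c (fun μ y => symHessFFAt (toSite (ctrOff (d + 1) Lc)) Lc μ y) b.2 (b.1 : Site (d + 1))))).submatrix
            (fun b : ↥(pbox (fine Lc M')) × Fin (d + 1) => ((b.1, Sum.inl b.2) : Idx (fine Lc M') (Fib d)))
            (fun b : ↥(pbox (fine Lc M')) × Fin (d + 1) => ((b.1, Sum.inl b.2) : Idx (fine Lc M') (Fib d)))))
        * Matrix.fromCols D₂ D₁
      = (w / (2 * (Lc : ℝ) ^ (d + 1))) •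
        (Matrix.of (fun (v : ↥(pbox (fine Lc M')) × Fin (d + 1)) (e : γ₂ ⊕ γ₁) =>
            (∑ a : ↥(pbox M') × Fin (d + 1), Q₁₀ a v *
                ∑ b : ↥(pbox (fine Lc M')) × Fin (d + 1), h b * ∑' m : Site (d + 1), c a.2 (translate M' (a.1 : Site (d + 1)) m) b.2 (b.1 : Site (d + 1)))
              * ((Sum.elim (fun (t : γ₂) (z : Site (d + 1)) => tdelta M' (quo Lc z) (g₂ t)) (fun (s : γ₁) (z : Site (d + 1)) => tdelta (fine Lc M') z (g₁ s)) e) (v.1 : Site (d + 1)) + (Sum.elim (fun (t : γ₂) (z : Site (d + 1)) => tdelta M' (quo Lc z) (g₂ t)) (fun (s : γ₁) (z : Site (d + 1)) => tdelta (fine Lc M') z (g₁ s)) e) ((v.1 : Site (d + 1)) + unitVec v.2)))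
          - Q₁₀ᵀ * Matrix.of (fun (a : ↥(pbox M') × Fin (d + 1)) (e : γ₂ ⊕ γ₁) =>
            (∑ b : ↥(pbox (fine Lc M')) × Fin (d + 1), h b * ∑' m : Site (d + 1), c a.2 (translate M' (a.1 : Site (d + 1)) m) b.2 (b.1 : Site (d + 1)))
              * ((Sum.elim (fun (t : γ₂) (z : Site (d + 1)) => tdelta M' (quo Lc z) (g₂ t)) (fun (s : γ₁) (z : Site (d + 1)) => tdelta (fine Lc M') z (g₁ s)) e) ((Lc : ℤ) • (a.1 : Site (d + 1)) + toSite (ctrOff (d + 1) Lc))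
                  + (Sum.elim (fun (t : γ₂) (z : Site (d + 1)) => tdelta M' (quo Lc z) (g₂ t)) (fun (s : γ₁) (z : Site (d + 1)) => tdelta (fine Lc M') z (g₁ s)) e) ((Lc : ℤ) • (a.1 : Site (d + 1)) + toSite (ctrOff (d + 1) Lc) + (Lc : ℤ) • unitVec a.2)))) := by
  have hLc1 : 1 ≤ Lc := Nat.one_le_iff_ne_zero.mpr (NeZero.ne Lc)
  rw [torus_a1_lam M' Lc (ctrOff_mem_box (d := d + 1) hLc1) g₁ g₂ w h c hc hD₁ hD₂]
  ext v e
  simp only [Matrix.smul_apply, Matrix.of_apply, Matrix.sub_apply, Matrix.mul_apply, Matrix.transpose_apply, smul_eq_mul,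
    tsum_coarse_regroup M' Lc hQ₁₀ g₁ g₂]
  -- finite bookkeeping over `b`, `μ`, `y₀` versus `a = (y₀, μ)`
  exact bookkeeping w (2 * (Lc : ℝ) ^ (d + 1)) ((Sum.elim (fun (t : γ₂) (z : Site (d + 1)) => tdelta M' (quo Lc z) (g₂ t)) (fun (s : γ₁) (z : Site (d + 1)) => tdelta (fine Lc M') z (g₁ s)) e) (v.1 : Site (d + 1))) ((Sum.elim (fun (t : γ₂) (z : Site (d + 1)) => tdelta M' (quo Lc z) (g₂ t)) (fun (s : γ₁) (z : Site (d + 1)) => tdelta (fine Lc M') z (g₁ s)) e) ((v.1 : Site (d + 1)) + unitVec v.2)) h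
    (fun μ (y₀ : ↥(pbox M')) (b : ↥(pbox (fine Lc M')) × Fin (d + 1)) => ∑' m : Site (d + 1), c μ (translate M' (y₀ : Site (d + 1)) m) b.2 (b.1 : Site (d + 1)))
    (fun (y₀ : ↥(pbox M')) => (Sum.elim (fun (t : γ₂) (z : Site (d + 1)) => tdelta M' (quo Lc z) (g₂ t)) (fun (s : γ₁) (z : Site (d + 1)) => tdelta (fine Lc M') z (g₁ s)) e) ((Lc : ℤ) • (y₀ : Site (d + 1)) + toSite (ctrOff (d + 1) Lc)))
    (fun (y₀ : ↥(pbox M')) μ => (Sum.elim (fun (t : γ₂) (z : Site (d + 1)) => tdelta M' (quo Lc z) (g₂ t)) (fun (s : γ₁) (z : Site (d + 1)) => tdelta (fine Lc M') z (g₁ s)) e) ((Lc : ℤ) • (y₀ : Site (d + 1)) + toSite (ctrOff (d + 1) Lc) + (Lc : ℤ) • unitVec μ))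
    (fun a => Q₁₀ a v)

end Regroup

end Summit.QuantumFields.BalabanUV.Beta.FP.PeriodisedLamGaugeLegDoor

end
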